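import Summits.Ventures.LatticeQCDFlow.Scaling.GraphSchemeOneLevelModes
import Summits.Ventures.LatticeQCDFlow.Scaling.HomStarLazyLawFreeFloor

/-!
HONEST FRAMING: exact (Metropolis-corrected) sampling algorithms for lattice gauge theory; figures
of merit are autocorrelation/cost numbers at stated couplings and volumes; no continuum-physics
claim.

# GraphSchemeAugmentation — A HOMOGENEOUS EXCHANGE SCHEME ON ANY SWAP LIST TAGGED WITH ITS STALE SET: THE SCHEME IS `t·T_e + h·R + (1−t−h)·I` (`T_e` THE LIST'S TRANSPOSITION
# PROPOSAL, `R` THE HOT REDRAW), THE AUGMENTED CHAIN ON `(configuration, stale set)` LUMPS ONTO THE SCHEME AND ONTO THE STALE-SET CHAIN OF FILE 4, AND ITS ONE-STEP ACTION ON LAWS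
# IS EXPLICIT (lean-2 GEN-47, ours)

Venture-side (OURS).  Cell `lqcd-flow` (pub-lqcd), unit `pub-lqcd-lean-2-g47`, 2026-08-31.  Chapter AH (the hub–ladder interpolation), file 5 — chapter AG file 7 (the path) and chapter L file 13
(the hub list) in one statement for ANY swap list `e` with distinct endpoints.  THE SCHEME in lazy form: `P = t·T_e + h·R + (1−t−h)·I`, `T_e` = a uniformly chosen entry of the list
transposes its two levels (every swap accepted, file 1), `R = coordKernel M 0` with the exact hot sampler, `0 ≤ t, h`, `t + h ≤ 1`; the weighted scheme `t·ptGraphSwap ν^{⊗} e 1 +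
(1−t)·prodKernel w M` with idle cold kernels is the case `h = (1−t)w_0` (`graphScheme_lazyForm`).  The AUGMENTED CHAIN carries the STALE SET `D`: entry `r` moves contents and stale labels
together (`z ↦ z∘(i_r l_r)`, `D ↦ (i_r l_r)(D)`), a redraw resamples `z_0 ∼ ν` and deletes `0`, the lazy part fixes both.  Hypothesis-equations `hPh`, `hP`, `hQ`; no definitions.

* §1 **`graphScheme_lazyForm`**; `image_swap_swap`, `eq_image_swap_comm`.
* §2 `graph_aug_isRowStochastic`; **`graph_lump_fst`**, **`graph_lump_snd`**; **`graph_lawAt_fst`** ∕ **`graph_lawAt_snd`**.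
* §3 **`graph_stepLaw_apply`** — `(λP̂)(z',D') = Σ_r (t/m)·λ(z'∘(i_r l_r), (i_r l_r)(D')) + h·Σ_{D : D∖{0} = D'} Σ_u λ(z'[0↦u], D)·M_0(u, z'_0) + (1−t−h)·λ(z',D')`.

Literature grade (cell rule): OWN CONSTRUCTION (chapter L's, for any list); nothing cited; no new bib keys.
-/

noncomputable section

open Finset Function
open Literature.Probability.MarkovChains

namespace Summit.Ventures.LatticeQCDFlow.Scaling

variable {S : Type*} [Fintype S] [DecidableEq S] {K m : ℕ} (e : Fin m → Fin (K + 1) × Fin (K + 1)) {ν : S → ℝ} {M : Fin (K + 1) → S → S → ℝ} {w : Fin (K + 1) → ℝ} {t h : ℝ}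

/-! ## §1 The lazy form of the weighted scheme; swaps of stale sets -/

/-- **THE WEIGHTED HOMOGENEOUS SCHEME IN LAZY FORM:** with one law at every level and idle cold kernels,
`t·GSw_e + (1−t)·Upd_w = t·T_e + (1−t)w_0·coordKernel M 0 + (1−t)(1−w_0)·I` (`m ≥ 1`, distinct endpoints, `ν > 0`, `Σw = 1`). [ours] -/
theorem graphScheme_lazyForm (hm : 1 ≤ m) (he : ∀ r, (e r).1 ≠ (e r).2) (hν : ∀ v, 0 < ν v) (hidle : ∀ i : Fin K, ∀ u v, M i.succ u v = if v = u then 1 else 0)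
    (hw1 : ∑ k, w k = 1) (x y : Fin (K + 1) → S) :
    t * ptGraphSwap (fun _ : Fin (K + 1) => ν) e (fun _ => Equiv.refl S) x y + (1 - t) * prodKernel w M x y
      = t * ptGraphProposal e (fun _ => Equiv.refl S) x y + (1 - t) * w 0 * coordKernel M 0 x y + (1 - t - (1 - t) * w 0) * (if y = x then 1 else 0) := by
  rw [ptGraphSwap_const_eq_proposal_of_ne e hm he hν, prodKernel_idle_eq hidle hw1, prodKernel_hotOnly]
  ring

omit [Fintype S] [DecidableEq S] in
/-- `(i l)((i l)(E)) = E` for stale sets. [ours] -/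
theorem image_swap_swap (i l : Fin (K + 1)) (E : Finset (Fin (K + 1))) : (E.image (Equiv.swap i l)).image (Equiv.swap i l) = E := by
  rw [Finset.image_image]
  convert Finset.image_id (s := E) using 2
  funext k
  simp [Equiv.swap_apply_self]

omit [Fintype S] [DecidableEq S] in
/-- `D' = (i l)(D) ↔ D = (i l)(D')`. [ours] -/
theorem eq_image_swap_comm (i l : Fin (K + 1)) (D D' : Finset (Fin (K + 1))) : D' = D.image (Equiv.swap i l) ↔ D = D'.image (Equiv.swap i l) := by
  constructor
  · intro h'; rw [h', image_swap_swap]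
  · intro h'; rw [h', image_swap_swap]

/-! ## §2 The augmented chain and its two lumpings -/

section Aug
variable {Ph : (Fin (K + 1) → S) × Finset (Fin (K + 1)) → (Fin (K + 1) → S) × Finset (Fin (K + 1)) → ℝ}
  {P : (Fin (K + 1) → S) → (Fin (K + 1) → S) → ℝ} {Q : Finset (Fin (K + 1)) → Finset (Fin (K + 1)) → ℝ}

/-- The augmented chain is a transition matrix (`K ≥ 1`, `t, h ≥ 0`, `t + h ≤ 1`, `M_0` row-stochastic). [ours] -/
theorem graph_aug_isRowStochastic (hm : 1 ≤ m) (ht0 : 0 ≤ t) (hh0 : 0 ≤ h) (hth : t + h ≤ 1) (hM : ∀ k, IsRowStochastic (M k))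
    (hPh : ∀ p q, Ph p q = (∑ r : Fin m, t / m * (if q.1 = edgeFlowSwap (Equiv.refl S) (e r).1 (e r).2 p.1 ∧ q.2 = p.2.image (Equiv.swap (e r).1 (e r).2) then (1 : ℝ) else 0))
      + h * (coordKernel M 0 p.1 q.1 * (if q.2 = p.2.erase 0 then (1 : ℝ) else 0)) + (1 - t - h) * (if q.1 = p.1 ∧ q.2 = p.2 then (1 : ℝ) else 0)) :
    IsRowStochastic Ph := by
  have hmpos : (0 : ℝ) < m := Nat.cast_pos.mpr (by omega)
  refine ⟨fun p q => ?_, fun p => ?_⟩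
  · rw [hPh]
    exact add_nonneg (add_nonneg (sum_nonneg fun j _ => mul_nonneg (by positivity) (by split_ifs <;> norm_num))
      (mul_nonneg hh0 (mul_nonneg (coordKernel_nonneg M (fun j u v => (hM j).1 u v) 0 _ _) (by split_ifs <;> norm_num))))
      (mul_nonneg (by linarith) (by split_ifs <;> norm_num))
  · -- each of the three parts has unit mass
    have h1 : ∀ r : Fin m, ∑ q : (Fin (K + 1) → S) × Finset (Fin (K + 1)),
        (if q.1 = edgeFlowSwap (Equiv.refl S) (e r).1 (e r).2 p.1 ∧ q.2 = p.2.image (Equiv.swap (e r).1 (e r).2) then (1 : ℝ) else 0) = 1 := by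
      intro r
      rw [Finset.sum_eq_single (edgeFlowSwap (Equiv.refl S) (e r).1 (e r).2 p.1, p.2.image (Equiv.swap (e r).1 (e r).2))]
      · rw [if_pos ⟨rfl, rfl⟩]
      · intro q _ hq; rw [if_neg]; rintro ⟨h1, h2⟩; exact hq (Prod.ext h1 h2)
      · intro h; exact absurd (mem_univ _) h
    have h2 : ∑ q : (Fin (K + 1) → S) × Finset (Fin (K + 1)), coordKernel M 0 p.1 q.1 * (if q.2 = p.2.erase 0 then (1 : ℝ) else 0) = 1 := by
      rw [Fintype.sum_prod_type]
      have : ∀ z : Fin (K + 1) → S, ∑ D : Finset (Fin (K + 1)),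
          coordKernel M 0 p.1 (z, D).1 * (if (z, D).2 = p.2.erase 0 then (1 : ℝ) else 0) = coordKernel M 0 p.1 z := by
        intro z; dsimp only
        rw [← Finset.mul_sum, Finset.sum_ite_eq' univ (p.2.erase 0), if_pos (mem_univ _), mul_one]
      simp_rw [this]
      exact sum_coordKernel_zero_eq_one hM p.1
    have h3 : ∑ q : (Fin (K + 1) → S) × Finset (Fin (K + 1)), (if q.1 = p.1 ∧ q.2 = p.2 then (1 : ℝ) else 0) = 1 := by
      rw [Finset.sum_eq_single p]
      · rw [if_pos ⟨rfl, rfl⟩]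
      · intro q _ hq; rw [if_neg]; rintro ⟨h1, h2⟩; exact hq (Prod.ext h1 h2)
      · intro h; exact absurd (mem_univ _) h
    have hsplit : ∑ q, Ph p q = (∑ r : Fin m, t / m * ∑ q : (Fin (K + 1) → S) × Finset (Fin (K + 1)),
        (if q.1 = edgeFlowSwap (Equiv.refl S) (e r).1 (e r).2 p.1 ∧ q.2 = p.2.image (Equiv.swap (e r).1 (e r).2) then (1 : ℝ) else 0))
        + h * ∑ q : (Fin (K + 1) → S) × Finset (Fin (K + 1)), coordKernel M 0 p.1 q.1 * (if q.2 = p.2.erase 0 then (1 : ℝ) else 0)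
        + (1 - t - h) * ∑ q : (Fin (K + 1) → S) × Finset (Fin (K + 1)), (if q.1 = p.1 ∧ q.2 = p.2 then (1 : ℝ) else 0) := by
      have hsw : ∑ r : Fin m, t / m * ∑ q : (Fin (K + 1) → S) × Finset (Fin (K + 1)),
          (if q.1 = edgeFlowSwap (Equiv.refl S) (e r).1 (e r).2 p.1 ∧ q.2 = p.2.image (Equiv.swap (e r).1 (e r).2) then (1 : ℝ) else 0)
          = ∑ q : (Fin (K + 1) → S) × Finset (Fin (K + 1)), ∑ r : Fin m, t / m *
            (if q.1 = edgeFlowSwap (Equiv.refl S) (e r).1 (e r).2 p.1 ∧ q.2 = p.2.image (Equiv.swap (e r).1 (e r).2) then (1 : ℝ) else 0) := by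
        rw [Finset.sum_comm]; simp_rw [Finset.mul_sum]
      rw [hsw, Finset.mul_sum, Finset.mul_sum, ← Finset.sum_add_distrib, ← Finset.sum_add_distrib]
      exact sum_congr rfl fun q _ => by rw [hPh]
    rw [hsplit]
    simp_rw [h1, h2, h3, mul_one, sum_const, card_univ, Fintype.card_fin, nsmul_eq_mul]
    field_simp; ring

/-- **FIRST LUMPING: the configuration marginal of the augmented chain is the lazy ladder `t·T + h·R + (1−t−h)·I`.** [ours] -/
theorem graph_lump_fst
    (hPh : ∀ p q, Ph p q = (∑ r : Fin m, t / m * (if q.1 = edgeFlowSwap (Equiv.refl S) (e r).1 (e r).2 p.1 ∧ q.2 = p.2.image (Equiv.swap (e r).1 (e r).2) then (1 : ℝ) else 0))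
      + h * (coordKernel M 0 p.1 q.1 * (if q.2 = p.2.erase 0 then (1 : ℝ) else 0)) + (1 - t - h) * (if q.1 = p.1 ∧ q.2 = p.2 then (1 : ℝ) else 0))
    (hP : ∀ x y, P x y = t * ptGraphProposal e (fun _ => Equiv.refl S) x y + h * coordKernel M 0 x y + (1 - t - h) * (if y = x then 1 else 0))
    (p : (Fin (K + 1) → S) × Finset (Fin (K + 1))) (z' : Fin (K + 1) → S) :
    P p.1 z' = ∑ q ∈ univ.filter (fun q : (Fin (K + 1) → S) × Finset (Fin (K + 1)) => q.1 = z'), Ph p q := by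
  rw [sum_filter_prodFst_eq, hP]
  simp_rw [hPh, Finset.sum_add_distrib]
  congr 1; congr 1
  · unfold ptGraphProposal
    rw [Finset.mul_sum, Finset.sum_comm]
    refine sum_congr rfl fun r _ => ?_
    rw [← Finset.mul_sum]
    by_cases hz : z' = edgeFlowSwap (Equiv.refl S) (e r).1 (e r).2 p.1
    · rw [if_pos hz]
      have : ∑ D' : Finset (Fin (K + 1)), (if z' = edgeFlowSwap (Equiv.refl S) (e r).1 (e r).2 p.1 ∧ D' = p.2.image (Equiv.swap (e r).1 (e r).2) then (1 : ℝ) else 0) = 1 := by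
        simp_rw [hz, true_and]
        rw [Finset.sum_ite_eq' univ, if_pos (mem_univ _)]
      rw [this]; ring
    · rw [if_neg hz]
      have : ∑ D' : Finset (Fin (K + 1)), (if z' = edgeFlowSwap (Equiv.refl S) (e r).1 (e r).2 p.1 ∧ D' = p.2.image (Equiv.swap (e r).1 (e r).2) then (1 : ℝ) else 0) = 0 :=
        sum_eq_zero fun D' _ => if_neg fun h' => hz h'.1
      rw [this]; ring
  · rw [← Finset.mul_sum]
    congr 1
    rw [← Finset.mul_sum, Finset.sum_ite_eq' univ (p.2.erase 0), if_pos (mem_univ _), mul_one]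
  · rw [← Finset.mul_sum]
    congr 1
    by_cases hz : z' = p.1
    · rw [if_pos hz]
      simp_rw [hz, true_and]
      rw [Finset.sum_ite_eq' univ, if_pos (mem_univ _)]
    · rw [if_neg hz]
      exact (sum_eq_zero fun D' _ => if_neg fun h' => hz h'.1).symm

/-- **SECOND LUMPING: the stale-set marginal of the augmented chain is the stale-set chain `Q` of file 6.** [ours] -/
theorem graph_lump_snd (hM : ∀ k, IsRowStochastic (M k))
    (hPh : ∀ p q, Ph p q = (∑ r : Fin m, t / m * (if q.1 = edgeFlowSwap (Equiv.refl S) (e r).1 (e r).2 p.1 ∧ q.2 = p.2.image (Equiv.swap (e r).1 (e r).2) then (1 : ℝ) else 0))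
      + h * (coordKernel M 0 p.1 q.1 * (if q.2 = p.2.erase 0 then (1 : ℝ) else 0)) + (1 - t - h) * (if q.1 = p.1 ∧ q.2 = p.2 then (1 : ℝ) else 0))
    (hQ : ∀ D D', Q D D' = (∑ r : Fin m, t / m * (if D' = D.image (Equiv.swap (e r).1 (e r).2) then (1 : ℝ) else 0))
      + h * (if D' = D.erase 0 then (1 : ℝ) else 0) + (1 - t - h) * (if D' = D then (1 : ℝ) else 0))
    (p : (Fin (K + 1) → S) × Finset (Fin (K + 1))) (D' : Finset (Fin (K + 1))) :
    Q p.2 D' = ∑ q ∈ univ.filter (fun q : (Fin (K + 1) → S) × Finset (Fin (K + 1)) => q.2 = D'), Ph p q := by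
  rw [sum_filter_prodSnd_eq, hQ]
  simp_rw [hPh, Finset.sum_add_distrib]
  congr 1; congr 1
  · rw [Finset.sum_comm]
    refine sum_congr rfl fun r _ => ?_
    rw [← Finset.mul_sum]
    congr 1
    by_cases hD : D' = p.2.image (Equiv.swap (e r).1 (e r).2)
    · rw [if_pos hD]
      simp_rw [hD, and_true]
      rw [Finset.sum_ite_eq' univ, if_pos (mem_univ _)]
    · rw [if_neg hD]
      exact (sum_eq_zero fun z _ => if_neg fun h' => hD h'.2).symm
  · rw [← Finset.mul_sum]
    congr 1
    calc (if D' = p.2.erase 0 then (1 : ℝ) else 0)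
        = (∑ z : Fin (K + 1) → S, coordKernel M 0 p.1 z) * (if D' = p.2.erase 0 then (1 : ℝ) else 0) := by
          rw [sum_coordKernel_zero_eq_one hM, one_mul]
      _ = ∑ z : Fin (K + 1) → S, coordKernel M 0 p.1 z * (if D' = p.2.erase 0 then (1 : ℝ) else 0) := Finset.sum_mul _ _ _
  · rw [← Finset.mul_sum]
    congr 1
    by_cases hD : D' = p.2
    · rw [if_pos hD]
      simp_rw [hD, and_true]
      rw [Finset.sum_ite_eq' univ, if_pos (mem_univ _)]
    · rw [if_neg hD]
      exact (sum_eq_zero fun z _ => if_neg fun h' => hD h'.2).symm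

/-- **From `δ_{(x, univ)}`: the configuration marginal of the augmented chain at time `n` is `δ_xPⁿ`.** [ours] -/
theorem graph_lawAt_fst
    (hPh : ∀ p q, Ph p q = (∑ r : Fin m, t / m * (if q.1 = edgeFlowSwap (Equiv.refl S) (e r).1 (e r).2 p.1 ∧ q.2 = p.2.image (Equiv.swap (e r).1 (e r).2) then (1 : ℝ) else 0))
      + h * (coordKernel M 0 p.1 q.1 * (if q.2 = p.2.erase 0 then (1 : ℝ) else 0)) + (1 - t - h) * (if q.1 = p.1 ∧ q.2 = p.2 then (1 : ℝ) else 0))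
    (hP : ∀ x y, P x y = t * ptGraphProposal e (fun _ => Equiv.refl S) x y + h * coordKernel M 0 x y + (1 - t - h) * (if y = x then 1 else 0))
    (x : Fin (K + 1) → S) (n : ℕ) (z : Fin (K + 1) → S) :
    ∑ D : Finset (Fin (K + 1)), lawAt Ph (Pi.single (x, (univ : Finset (Fin (K + 1)))) 1) n (z, D) = lawAt P (Pi.single x 1) n z := by
  rw [← sum_filter_prodFst_eq (fun q => lawAt Ph (Pi.single (x, (univ : Finset (Fin (K + 1)))) 1) n q) z,
    LevinPeres2017_lemma_2_5_lawAt (P := Ph) (proj := Prod.fst) (Ps := P) (fun p z' => graph_lump_fst e hPh hP p z')]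
  congr 1
  funext z'
  exact sum_filter_prodFst_single x univ z'

/-- **From `δ_{(x, univ)}`: the stale-set marginal at time `n` is `δ_{univ}Qⁿ`, the same for every start `x`.** [ours] -/
theorem graph_lawAt_snd (hM : ∀ k, IsRowStochastic (M k))
    (hPh : ∀ p q, Ph p q = (∑ r : Fin m, t / m * (if q.1 = edgeFlowSwap (Equiv.refl S) (e r).1 (e r).2 p.1 ∧ q.2 = p.2.image (Equiv.swap (e r).1 (e r).2) then (1 : ℝ) else 0))
      + h * (coordKernel M 0 p.1 q.1 * (if q.2 = p.2.erase 0 then (1 : ℝ) else 0)) + (1 - t - h) * (if q.1 = p.1 ∧ q.2 = p.2 then (1 : ℝ) else 0))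
    (hQ : ∀ D D', Q D D' = (∑ r : Fin m, t / m * (if D' = D.image (Equiv.swap (e r).1 (e r).2) then (1 : ℝ) else 0))
      + h * (if D' = D.erase 0 then (1 : ℝ) else 0) + (1 - t - h) * (if D' = D then (1 : ℝ) else 0))
    (x : Fin (K + 1) → S) (n : ℕ) (D : Finset (Fin (K + 1))) :
    ∑ z : Fin (K + 1) → S, lawAt Ph (Pi.single (x, (univ : Finset (Fin (K + 1)))) 1) n (z, D) = lawAt Q (Pi.single (univ : Finset (Fin (K + 1))) 1) n D := by
  rw [← sum_filter_prodSnd_eq (fun q => lawAt Ph (Pi.single (x, (univ : Finset (Fin (K + 1)))) 1) n q) D,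
    LevinPeres2017_lemma_2_5_lawAt (P := Ph) (proj := Prod.snd) (Ps := Q) (fun p D' => graph_lump_snd e hM hPh hQ p D')]
  congr 1
  funext D'
  exact sum_filter_prodSnd_single x univ D'

/-! ## §3 The one-step action on laws -/

/-- **THE ONE-STEP ACTION OF THE AUGMENTED CHAIN ON A LAW `λ`:**
`(λP̂)(z',D') = Σ_j (t/K)·λ(z'∘σ_j, σ_j(D')) + h·Σ_{D : D∖{0} = D'} Σ_u λ(z'[0↦u], D)·M_0(u, z'_0) + (1−t−h)·λ(z',D')`. [ours] -/
theorem graph_stepLaw_apply (he : ∀ r, (e r).1 ≠ (e r).2)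
    (hPh : ∀ p q, Ph p q = (∑ r : Fin m, t / m * (if q.1 = edgeFlowSwap (Equiv.refl S) (e r).1 (e r).2 p.1 ∧ q.2 = p.2.image (Equiv.swap (e r).1 (e r).2) then (1 : ℝ) else 0))
      + h * (coordKernel M 0 p.1 q.1 * (if q.2 = p.2.erase 0 then (1 : ℝ) else 0)) + (1 - t - h) * (if q.1 = p.1 ∧ q.2 = p.2 then (1 : ℝ) else 0))
    (lam : (Fin (K + 1) → S) × Finset (Fin (K + 1)) → ℝ) (z' : Fin (K + 1) → S) (D' : Finset (Fin (K + 1))) :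
    stepLaw Ph lam (z', D')
      = (∑ r : Fin m, t / m * lam (edgeFlowSwap (Equiv.refl S) (e r).1 (e r).2 z', D'.image (Equiv.swap (e r).1 (e r).2)))
        + h * (∑ D ∈ univ.filter (fun D : Finset (Fin (K + 1)) => D.erase 0 = D'), ∑ u : S, lam (update z' 0 u, D) * M 0 u (z' 0))
        + (1 - t - h) * lam (z', D') := by
  unfold stepLaw
  simp_rw [hPh, mul_add, Finset.sum_add_distrib]
  congr 1; congr 1
  · -- swap part: the unique predecessor of `(z', D')` under the entry `r`
    simp_rw [Finset.mul_sum]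
    rw [Finset.sum_comm]
    refine sum_congr rfl fun r _ => ?_
    have hinvz : ∀ z : Fin (K + 1) → S, z' = edgeFlowSwap (Equiv.refl S) (e r).1 (e r).2 z ↔ z = edgeFlowSwap (Equiv.refl S) (e r).1 (e r).2 z' :=
      fun z => eq_edgeFlowSwap_comm _ (he r) z z'
    have hinvD : ∀ D : Finset (Fin (K + 1)), D' = D.image (Equiv.swap (e r).1 (e r).2) ↔ D = D'.image (Equiv.swap (e r).1 (e r).2) :=
      fun D => eq_image_swap_comm (e r).1 (e r).2 D D'
    rw [Fintype.sum_prod_type]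
    simp_rw [hinvz, hinvD]
    rw [Finset.sum_eq_single (edgeFlowSwap (Equiv.refl S) (e r).1 (e r).2 z')]
    · rw [Finset.sum_eq_single (D'.image (Equiv.swap (e r).1 (e r).2))]
      · rw [if_pos ⟨rfl, rfl⟩]; ring
      · intro D _ hD
        rw [if_neg (fun h' => hD h'.2)]; ring
      · intro h'; exact absurd (mem_univ _) h'
    · intro z _ hz
      exact sum_eq_zero fun D _ => by rw [if_neg (fun h' => hz h'.1)]; ring
    · intro h'; exact absurd (mem_univ _) h'
  · -- redraw part
    simp_rw [Finset.mul_sum]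
    rw [Fintype.sum_prod_type, Finset.sum_comm, Finset.sum_filter]
    refine sum_congr rfl fun D _ => ?_
    by_cases hD : D' = D.erase 0
    · simp_rw [if_pos hD, mul_one, if_pos hD.symm]
      have h' := sum_mul_coordKernel_zero (M := M) (fun z => lam (z, D)) z'
      calc ∑ z, lam (z, D) * (h * coordKernel M 0 z z')
          = h * ∑ z, lam (z, D) * coordKernel M 0 z z' := by rw [Finset.mul_sum]; exact sum_congr rfl fun z _ => by ring
        _ = h * ∑ u : S, lam (update z' 0 u, D) * M 0 u (z' 0) := by rw [h']
        _ = ∑ u : S, h * (lam (update z' 0 u, D) * M 0 u (z' 0)) := by rw [Finset.mul_sum]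
    · simp_rw [if_neg hD, mul_zero, if_neg (fun h' : D.erase 0 = D' => hD h'.symm)]
      simp
  · -- lazy part
    rw [Fintype.sum_prod_type]
    rw [Finset.sum_eq_single z']
    · rw [Finset.sum_eq_single D']
      · rw [if_pos ⟨rfl, rfl⟩]; ring
      · intro D _ hD; rw [if_neg (fun h' => hD h'.2.symm)]; ring
      · intro h'; exact absurd (mem_univ _) h'
    · intro z _ hz
      exact sum_eq_zero fun D _ => by rw [if_neg (fun h' => hz h'.1.symm)]; ring
    · intro h'; exact absurd (mem_univ _) h'

end Aug

end Summit.Ventures.LatticeQCDFlow.Scaling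

end
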